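import Summits.QuantumAdvantage.AdviceFreeQNC0.WalkTubeLinear
import Summits.QuantumAdvantage.AdviceFreeQNC0.WalkTubeMass
import HarnessLib

/-!
# Cell qa-qnc0 (rung F-Q1; density axis): `T10W` and the ΣΠΣ separation `SPSRingFailPoly` —
# UNCONDITIONAL

`WalkTubeLinear.lean` (prover qn-prover-3 gen 7): `TubeMass → ∀ c > 0, RingFailLinearWalk c`,
`TubeMass → T10W`, `TubeMass → SPSRingFailPoly`.  `WalkTubeMass.lean` (prover qa-qnc0-prover gen 9 on
planner qa-qnc0-p2's ROUND-11 plan; reflection principle): `tubeMass : TubeMass`.  Hence: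

* `ringFailLinearWalk_all : ∀ c > 0, RingFailLinearWalk c` — every walk strategy of degree `≤ D`
  (`D ≥ D₀(c)`, `n ≥ λ(c)·D`, every charge) fails on at least `2^{−cD}·2ⁿ` inputs, for EVERY `c > 0`
  (planner qa-qnc0-p1's density axis: the kernel exponent is now `0⁺`; `T10W` asked for `< 1`);
* `t10W : T10W`;
* **`spsRingFailPoly : SPSRingFailPoly`** — the advice-free, non-interactive separation
  `QNC⁰ ⊄ ΣΠΣ_𝔽₂(poly)` with inverse-polynomial soundness gap for the cycle graph-state relation
  (`SPSRingFail.lean`, planner qa-qnc0-p1 Sketch13: `spsRingFailPoly_of_t10W` + qn-lit's `spsApprox`),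
  until now conditional on MULT₁ / `MassIneqAll 15` (`DensityAxisPayoff.lean`) — PROVED, the tensor /
  Mass-Inequality programme being bypassed by the tube bound.

The cell's theorem (prover qn-prover-3 gen 7, 2026-08-27); ingredients by planner qa-qnc0-p2 (tube
bound), provers qa-qnc0-prover gen 9 (`tubeBound`, `tubeMass`, `binomTailLower`), qn-lit (`spsApprox`),
qn-prover (`b10R`), planner qa-qnc0-p1 (the density-axis chain).  WHAT THIS IS NOT: the rung leaf
`AdviceFreeQNC0` / α is the business of `RingFrameRingToElim.lean`; constants absolute but tiny; no
claim beyond `SPSRingFailPoly` as typed.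
-/

noncomputable section

namespace Summit.QuantumAdvantage.AdviceFreeQNC0

/-- **The density axis, closed**: `RingFailLinearWalk c` for EVERY `c > 0`. -/
theorem ringFailLinearWalk_all {c : ℝ} (hc : 0 < c) : RingFailLinearWalk c :=
  ringFailLinearWalk_of_tubeMass tubeMass hc

/-- **`T10W` holds.** -/
theorem t10W : T10W := t10W_of_tubeMass tubeMass

/-- **`SPSRingFailPoly` holds**: advice-free `QNC⁰ ⊄ ΣΠΣ_𝔽₂(poly)` for the cycle graph-state
relation, with inverse-polynomial soundness gap. -/
theorem spsRingFailPoly : SPSRingFailPoly := spsRingFailPoly_of_tubeMass tubeMass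

end Summit.QuantumAdvantage.AdviceFreeQNC0

end
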